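import Summits.QuantumFields.YangMills.Theorems.SwapVirialDeficitZeroModeThreeColumns
import Summits.QuantumFields.YangMills.Theorems.SwapVirialDeficitZeroModeGroupThreeGaussian
import HarnessLib

/-!
# The `k = 3` zero-mode block is REGULAR, VIII: the CLOSED FORM `A₃ = 4π⁴√(2π)` — part 1, the transverse Gaussians
# (free-hands support of ⟨stmt-QuantumFields-24197⟩; pins the constant of w3 g62's ✓`tendsto_zeroModeZ_three` / ✓`ofReal_A3_eq`)

✓`ofReal_A3_eq` (w3 g62): `A₃ = ∫_{ℝ³} da ∫_{(ℝ³)²} dy h_∞(‖a‖, y)` with the `β = ∞` integrand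
`h_∞(r,y) = exp(−[cr(y₀,y₁) + r²(plSq y₀ + plSq y₁)] − (y₀₂² + y₁₂² + r²)/2)`.  In the coordinates `((u₀,v₀),((u₁,v₁),(z₀,z₁)))`,
`u_i = y₀ᵢ`, `v_i = y₁ᵢ` (`i = 0,1`), `z = (y₀₂, y₁₂)`, the exponent is `−Σ_i Q_{r,z}(u_i,v_i) − (|z|² + r²)/2` with the COUPLED transverse form
`Q_{r,z}(p) = (r² + z₁²)p₁² − 2z₀z₁p₁p₂ + (r² + z₀²)p₂²` of discriminant `r²(r² + |z|²)`; two exact coupled Gaussians (w2 g55's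
✓`lintegral_exp_neg_quadForm_two`) give ★★ `lintegral_hlim_eq`: `∫ h_∞(r,·) = ∫_{ℝ²} π²·e^{−(|z|²+r²)/2}/(r²(r² + |z|²)) dz` (`r ≠ 0`).
Part 2 integrates the hub with `e^{−X/2}/X = ∫_{1/2}^∞ e^{−cX}dc`, `1/X = ∫₀^∞ e^{−uX}du` and Gaussian integrals only: `A₃ = 4π⁴√(2π)`.
HONEST LABEL: finite-dimensional calculus (plan-level zero-mode rung of a DRAFT line «sharp-sigma»); NOT the fixed-`L` sharp law, NOT ⟨24197⟩; the Yang–Mills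
mass gap is NOT proved; no summit is proved by a line.  Width seat ym-line-sfw-p2-w2 g56 (cell ym-idea-1, free hands; own crux ⟨22884⟩ blocked-on ⟨19935⟩),
`--supports stmt-QuantumFields-24197`.  Standard axioms, 0 `sorry`.  References: [folklore].
-/

set_option autoImplicit false

noncomputable section
namespace Summit.QuantumFields.YangMills.Theorems.ToronValleyVolume.ZeroMode

open MeasureTheory Real Finset Set Filter
open scoped ENNReal Topology
open Summit.QuantumFields.YangMills.Cruxes.ToronTubeVolumeLaw.Birth
open Summit.QuantumFields.YangMills.Theorems.SwapVirialDeficit.ZeroModeGroup (lintegral_exp_neg_quadForm_two split3 split3_apply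
  measurePreserving_split3 measurePreserving_prodInterchange)

/-! ## §22 Coordinates on `(ℝ³)²` grouping the transverse pairs -/

/-- Coordinates on one column: `u ↦ (u₀, (u₁, u₂))`. [folklore] -/
def coordE (u : EuclideanSpace ℝ (Fin 3)) : ℝ × (ℝ × ℝ) := (u 0, (u 1, u 2))

/-- `coordE = split3 ∘ ofLp`. [folklore] -/
theorem coordE_eq : coordE = split3 ∘ (WithLp.ofLp : EuclideanSpace ℝ (Fin 3) → (Fin 3 → ℝ)) := by
  funext u; rw [Function.comp_apply, split3_apply]; rfl

/-- `coordE` preserves Lebesgue measure. [folklore] -/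
theorem measurePreserving_coordE : MeasurePreserving coordE volume volume := by
  rw [coordE_eq]; exact measurePreserving_split3.comp (PiLp.volume_preserving_ofLp (Fin 3))

/-- The pair frame of the two columns: `y ↦ ((y₀₀,y₁₀), ((y₀₁,y₁₁), (y₀₂,y₁₂)))` (transverse pairs first, axial pair last). [folklore] -/
def pairE (y : Fin 2 → EuclideanSpace ℝ (Fin 3)) : (ℝ × ℝ) × ((ℝ × ℝ) × (ℝ × ℝ)) :=
  ((y 0 0, y 1 0), ((y 0 1, y 1 1), (y 0 2, y 1 2)))

/-- `pairE` as a composite of measure-preserving maps. [folklore] -/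
theorem pairE_eq : pairE =
    (Prod.map id (fun z : (ℝ × ℝ) × (ℝ × ℝ) => ((z.1.1, z.2.1), (z.1.2, z.2.2)))) ∘
      (fun z : (ℝ × (ℝ × ℝ)) × (ℝ × (ℝ × ℝ)) => ((z.1.1, z.2.1), (z.1.2, z.2.2))) ∘
      (Prod.map coordE coordE) ∘ (MeasurableEquiv.finTwoArrow : (Fin 2 → EuclideanSpace ℝ (Fin 3)) ≃ᵐ _) := by
  funext y; rfl

/-- ★ `pairE` carries Lebesgue measure on `(ℝ³)²` to Lebesgue measure. [folklore] -/
theorem measurePreserving_pairE : MeasurePreserving pairE volume volume := by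
  rw [pairE_eq]
  have h1 := volume_preserving_finTwoArrow (EuclideanSpace ℝ (Fin 3))
  have h2 : MeasurePreserving (Prod.map coordE coordE) (volume : Measure (EuclideanSpace ℝ (Fin 3) × EuclideanSpace ℝ (Fin 3)))
      (volume : Measure ((ℝ × (ℝ × ℝ)) × (ℝ × (ℝ × ℝ)))) := measurePreserving_coordE.prod measurePreserving_coordE
  have h3 : MeasurePreserving (fun z : (ℝ × (ℝ × ℝ)) × (ℝ × (ℝ × ℝ)) => ((z.1.1, z.2.1), (z.1.2, z.2.2)))
      (volume : Measure ((ℝ × (ℝ × ℝ)) × (ℝ × (ℝ × ℝ)))) (volume : Measure ((ℝ × ℝ) × ((ℝ × ℝ) × (ℝ × ℝ)))) :=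
    measurePreserving_prodInterchange (volume : Measure ℝ) (volume : Measure (ℝ × ℝ)) (volume : Measure ℝ) (volume : Measure (ℝ × ℝ))
  have h4 : MeasurePreserving (Prod.map id (fun z : (ℝ × ℝ) × (ℝ × ℝ) => ((z.1.1, z.2.1), (z.1.2, z.2.2))))
      (volume : Measure ((ℝ × ℝ) × ((ℝ × ℝ) × (ℝ × ℝ)))) (volume : Measure ((ℝ × ℝ) × ((ℝ × ℝ) × (ℝ × ℝ)))) :=
    (MeasurePreserving.id (volume : Measure (ℝ × ℝ))).prod
      (measurePreserving_prodInterchange (volume : Measure ℝ) (volume : Measure ℝ) (volume : Measure ℝ) (volume : Measure ℝ))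
  exact h4.comp (h3.comp (h2.comp h1))

/-! ## §23 The limit integrand in the pair frame and the two coupled Gaussians -/

/-- The coupled transverse Gaussian at axial data `(r, z)`: `exp(−[(r²+z₁²)p₁² − 2z₀z₁p₁p₂ + (r²+z₀²)p₂²])`. [folklore] -/
def gz (r : ℝ) (z p : ℝ × ℝ) : ℝ≥0∞ :=
  ENNReal.ofReal (Real.exp (-((r ^ 2 + z.2 ^ 2) * p.1 ^ 2 + 2 * (-(z.1 * z.2)) * p.1 * p.2 + (r ^ 2 + z.1 ^ 2) * p.2 ^ 2)))

/-- The axial weight `exp(−(|z|² + r²)/2)`. [folklore] -/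
def wz (r : ℝ) (z : ℝ × ℝ) : ℝ≥0∞ := ENNReal.ofReal (Real.exp (-((z.1 ^ 2 + z.2 ^ 2 + r ^ 2) / 2)))

/-- Unfolding `gz`. [folklore] -/
theorem gz_def (r : ℝ) (z p : ℝ × ℝ) : gz r z p =
    ENNReal.ofReal (Real.exp (-((r ^ 2 + z.2 ^ 2) * p.1 ^ 2 + 2 * (-(z.1 * z.2)) * p.1 * p.2 + (r ^ 2 + z.1 ^ 2) * p.2 ^ 2))) := rfl

/-- Unfolding `wz`. [folklore] -/
theorem wz_def (r : ℝ) (z : ℝ × ℝ) : wz r z = ENNReal.ofReal (Real.exp (-((z.1 ^ 2 + z.2 ^ 2 + r ^ 2) / 2))) := rfl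

/-- `gz` is jointly measurable. [folklore] -/
theorem measurable_gz (r : ℝ) : Measurable fun v : (ℝ × ℝ) × (ℝ × ℝ) => gz r v.1 v.2 := by
  unfold gz; exact ENNReal.measurable_ofReal.comp (Real.measurable_exp.comp (by fun_prop))

/-- `gz r z ·` is measurable. [folklore] -/
theorem measurable_gz_right (r : ℝ) (z : ℝ × ℝ) : Measurable (gz r z) := by
  have : Measurable fun p : ℝ × ℝ => gz r z p := by
    unfold gz; exact ENNReal.measurable_ofReal.comp (Real.measurable_exp.comp (by fun_prop))
  exact this

/-- `wz` is measurable. [folklore] -/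
theorem measurable_wz (r : ℝ) : Measurable (wz r) := by
  have : Measurable fun z : ℝ × ℝ => wz r z := by
    unfold wz; exact ENNReal.measurable_ofReal.comp (Real.measurable_exp.comp (by fun_prop))
  exact this

attribute [irreducible] gz wz

/-- The limit integrand in the pair frame: `g_z(w₁)·g_z(w₂)·w(z)`, `z = w.2.2`. [folklore] -/
def hlimW (r : ℝ) (w : (ℝ × ℝ) × ((ℝ × ℝ) × (ℝ × ℝ))) : ℝ≥0∞ := gz r w.2.2 w.1 * (gz r w.2.2 w.2.1 * wz r w.2.2)

/-- Unfolding `hlimW`. [folklore] -/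
theorem hlimW_def (r : ℝ) (w : (ℝ × ℝ) × ((ℝ × ℝ) × (ℝ × ℝ))) : hlimW r w = gz r w.2.2 w.1 * (gz r w.2.2 w.2.1 * wz r w.2.2) := rfl

/-- `hlimW` is measurable. [folklore] -/
theorem measurable_hlimW (r : ℝ) : Measurable (hlimW r) := by
  have h1 : Measurable fun w : (ℝ × ℝ) × ((ℝ × ℝ) × (ℝ × ℝ)) => gz r w.2.2 w.1 :=
    (measurable_gz r).comp ((measurable_snd.comp measurable_snd).prodMk measurable_fst)
  have h2 : Measurable fun w : (ℝ × ℝ) × ((ℝ × ℝ) × (ℝ × ℝ)) => gz r w.2.2 w.2.1 :=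
    (measurable_gz r).comp ((measurable_snd.comp measurable_snd).prodMk (measurable_fst.comp measurable_snd))
  have h3 : Measurable fun w : (ℝ × ℝ) × ((ℝ × ℝ) × (ℝ × ℝ)) => wz r w.2.2 := (measurable_wz r).comp (measurable_snd.comp measurable_snd)
  have : Measurable fun w : (ℝ × ℝ) × ((ℝ × ℝ) × (ℝ × ℝ)) => hlimW r w := by
    unfold hlimW; exact h1.mul (h2.mul h3)
  exact this

attribute [irreducible] hlimW

/-- ★ **The limit integrand IS `hlimW ∘ pairE`.** [folklore] -/
theorem ofReal_hlim_eq (r : ℝ) (y : Fin 2 → EuclideanSpace ℝ (Fin 3)) : ENNReal.ofReal (hlim r y) = hlimW r (pairE y) := by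
  rw [hlimW_def, gz_def, gz_def, wz_def]
  unfold hlim cr plSq
  simp only [pairE]
  rw [← ENNReal.ofReal_mul (Real.exp_pos _).le, ← ENNReal.ofReal_mul (Real.exp_pos _).le, ← Real.exp_add, ← Real.exp_add]
  congr 2
  ring

/-- ★ The exact coupled Gaussian at axial data: `∫ g_z = π/√(r²(r²+|z|²))` (`r ≠ 0`). [folklore] -/
theorem lintegral_gz {r : ℝ} (hr : r ≠ 0) (z : ℝ × ℝ) :
    ∫⁻ p, gz r z p = ENNReal.ofReal (Real.pi / Real.sqrt (r ^ 2 * (r ^ 2 + z.1 ^ 2 + z.2 ^ 2))) := by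
  have hr2 : 0 < r ^ 2 := by positivity
  have hD : (r ^ 2 + z.2 ^ 2) * (r ^ 2 + z.1 ^ 2) - (-(z.1 * z.2)) ^ 2 = r ^ 2 * (r ^ 2 + z.1 ^ 2 + z.2 ^ 2) := by ring
  have hpos : 0 < r ^ 2 * (r ^ 2 + z.1 ^ 2 + z.2 ^ 2) := by positivity
  simp_rw [gz_def]
  rw [lintegral_exp_neg_quadForm_two (by positivity) (by rw [hD]; exact hpos), hD]

/-- `(∫ g_z)² = π²/(r²(r²+|z|²))`. [folklore] -/
theorem lintegral_gz_mul_self {r : ℝ} (hr : r ≠ 0) (z : ℝ × ℝ) :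
    (∫⁻ p, gz r z p) * (∫⁻ p, gz r z p) = ENNReal.ofReal (Real.pi ^ 2 / (r ^ 2 * (r ^ 2 + z.1 ^ 2 + z.2 ^ 2))) := by
  have hpos : 0 < r ^ 2 * (r ^ 2 + z.1 ^ 2 + z.2 ^ 2) := by positivity
  rw [lintegral_gz hr, ← ENNReal.ofReal_mul (by positivity)]
  congr 1
  rw [div_mul_div_comm, Real.mul_self_sqrt hpos.le]; ring

/-- ★★ **THE TRANSVERSE GAUSSIANS, DONE**: `∫_{(ℝ³)²} h_∞(r,y) dy = ∫_{ℝ²} π²·e^{−(|z|²+r²)/2}/(r²(r²+|z|²)) dz` (`r ≠ 0`). [folklore] -/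
theorem lintegral_hlim_eq {r : ℝ} (hr : r ≠ 0) :
    ∫⁻ y, ENNReal.ofReal (hlim r y) =
      ∫⁻ z : ℝ × ℝ, ENNReal.ofReal (Real.pi ^ 2 / (r ^ 2 * (r ^ 2 + z.1 ^ 2 + z.2 ^ 2))) * wz r z := by
  simp_rw [ofReal_hlim_eq]
  rw [measurePreserving_pairE.lintegral_comp (measurable_hlimW r)]
  -- `z` outermost: `A × (B × C)` with `A = B = C = ℝ × ℝ`
  rw [Measure.volume_eq_prod, lintegral_prod_symm _ (measurable_hlimW r).aemeasurable]
  have hin : ∀ bc : (ℝ × ℝ) × (ℝ × ℝ), ∫⁻ a : ℝ × ℝ, hlimW r (a, bc) = (∫⁻ p, gz r bc.2 p) * (gz r bc.2 bc.1 * wz r bc.2) := by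
    intro bc
    simp_rw [hlimW_def]
    rw [lintegral_mul_const _ (measurable_gz_right r bc.2)]
  simp_rw [hin]
  rw [Measure.volume_eq_prod, lintegral_prod_symm]
  · refine lintegral_congr fun z => ?_
    have e : ∀ b : ℝ × ℝ, (∫⁻ p, gz r z p) * (gz r z b * wz r z) = gz r z b * ((∫⁻ p, gz r z p) * wz r z) := fun b => by ring
    simp_rw [e]
    rw [lintegral_mul_const _ (measurable_gz_right r z), ← mul_assoc, lintegral_gz_mul_self hr z]
  · have h1 : Measurable fun bc : (ℝ × ℝ) × (ℝ × ℝ) => ∫⁻ p, gz r bc.2 p := by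
      have : Measurable fun q : ((ℝ × ℝ) × (ℝ × ℝ)) × (ℝ × ℝ) => gz r q.1.2 q.2 :=
        (measurable_gz r).comp ((measurable_snd.comp measurable_fst).prodMk measurable_snd)
      exact this.lintegral_prod_right'
    have h2 : Measurable fun bc : (ℝ × ℝ) × (ℝ × ℝ) => gz r bc.2 bc.1 := (measurable_gz r).comp (measurable_snd.prodMk measurable_fst)
    exact (h1.mul (h2.mul ((measurable_wz r).comp measurable_snd))).aemeasurable

end Summit.QuantumFields.YangMills.Theorems.ToronValleyVolume.ZeroMode

end
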